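import Summits.QuantumFields.YangMills.Theorems.LuscherReductionDressedRitzPlateauDefs
import Summits.QuantumFields.YangMills.Theorems.LuscherReductionDressedRitzRitzInterlacing
import Summits.QuantumFields.YangMills.Theorems.FemtoTransferGapGroundState
import HarnessLib

/-!
# Route `LuscherReduction`, item `DressedRitz` (stmt-QuantumFields-20205) — the UPPER Lüscher position of `KTGen.DressedRitzAt k` is LEVEL data:
# `LevelUpperAt k → DressedRitzLowerAt k → DressedRitzAt k` (Cauchy interlacing; line-independent door variant, BLUEPRINT-S-UNIV §6)

Support module (LEAD prover ym-lead-20205-polyakovlift g0; `--supports stmt-QuantumFields-20205`, helper).  Clause (v) of `KTGen.DressedRitzAt k` pins every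
Ritz value TWO-SIDEDLY: `ρ_j μ₀ ≤ e^{Cλ²/L} μ_j ρ₀` (upper) and `μ_j ρ₀ ≤ e^{Cλ²/L} ρ_j μ₀` (lower).  By Cauchy interlacing (`RitzInterlace.ritz_le_levelValue`:
`ρ_j ≤ λ_j(β,L)` for every `l2`-orthonormal, `qform`-diagonal, antitone physical family) the UPPER half follows from the comparison of the EXACT fine levels with
the one-site levels — `KTGen.LevelUpperAt k`: `λ_j(β,L)·μ₀(B) ≤ e^{Cλ²/L}·μ_j(B)·λ₀(β,L)` for `j ≤ k` (one-loop universality of Lüscher's LEVELS, upper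
direction) — provided the family's top member is the exact vacuum value (`ρ₀ = λ₀`, as in every landed door: the vacuum is a member).  Hence

* `KTGen.LevelUpperAt k`      — the level statement (fine vs one-site level ratios, upper direction, `j ≤ k`);
* `KTGen.DressedRitzLowerAt k` — `DressedRitzAt k` with clause (v) replaced by «`ρ₀ = λ₀` ∧ LOWER halves only»;
* ★ `KTGen.dressedRitzAt_of_lower_levels : LevelUpperAt k → DressedRitzLowerAt k → DressedRitzAt k` (constant `max C₁ C₂`);
* ★★ `KTGen.levelUpperAt_of_runningReduction` — the SIBLING CRUX RED (`Theses.LuscherReduction.RunningReduction`, stmt-QuantumFields-19978: two-sided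
  one-loop level comparison, level by level) implies `LevelUpperAt k` for every `k`; hence `KTGen.dressedRitzAt_of_runningReduction_lower` and the
  route-level corollary `KTGen.dressedRitz_of_runningReduction_lower : RunningReduction → (∀ k, DressedRitzLowerAt k) → DressedRitz` — GIVEN RED (which the
  route needs anyway), the crux `DressedRitz` reduces to one-sided (lower) Lüscher position.

So any line on this crux may deliver ONE-SIDED (lower) Lüscher position — a variational statement «the trial Ritz values are not too low» — plus the level
comparison; the upper side is free.  HONEST FRAMING: fixed-lattice linear algebra on the conditional femto rung R2b1; `LevelUpperAt` and the lower halves are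
OPEN RG content; nothing here bears on infinite volume, the continuum limit or the Clay gap.  References: B. N. Parlett, The Symmetric Eigenvalue Problem §10.1
[cite: Parlett1998, §10.1]; M. Lüscher, NPB 219 (1983) 233 [cite: Luscher1983, §3].
-/

set_option autoImplicit false

noncomputable section

open MeasureTheory Filter Topology Real
open Literature.MathematicalPhysics.QuantumFieldTheory
open Literature.MathematicalPhysics.QuantumLattice
open Literature.Analysis.OperatorTheory.YMMatrixModel
open scoped BigOperators

namespace Summit.QuantumFields.YangMills.Theorems.FemtoTransferGap

/-- **`KTGen.LevelUpperAt k`** — upper one-loop universality of the first `k` fine LEVELS against the one-site levels: deep in the femto window,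
`λ_j(β,L)·μ₀(B) ≤ e^{Cλ²/L}·μ_j(B)·λ₀(β,L)` for all `j ≤ k` (`B = oneSiteCoupling β L`). [cite: Luscher1983, §3] -/
def KTGen.LevelUpperAt (k : ℕ) : Prop :=
  ∃ C lam0 : ℝ, 0 ≤ C ∧ 0 < lam0 ∧ ∀ lam : ℝ, 0 < lam → lam ≤ lam0 →
    ∃ L0 : ℕ, ∀ (L : ℕ) [NeZero L], L0 ≤ L → ∀ β : ℝ, InFemtoWindow lam β L →
      ∀ j : ℕ, j ≤ k →
        levelValue su2Rep L β j * levelValue su2Rep 1 (oneSiteCoupling β L) 0 ≤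
          Real.exp (C * luscherLambda β L ^ 2 / L) * (levelValue su2Rep 1 (oneSiteCoupling β L) j * levelValue su2Rep L β 0)

/-- **`KTGen.DressedRitzLowerAt k`** — `KTGen.DressedRitzAt k` with clause (v) replaced by: the top member carries the exact vacuum value (`ρ₀ = λ₀`) and the
Ritz values are in LOWER Lüscher position only (`μ_j ρ₀ ≤ e^{Cλ²/L} ρ_j μ₀`).  All other clauses verbatim. [cite: LuscherWolff1990] -/
def KTGen.DressedRitzLowerAt (k : ℕ) : Prop :=
  ∀ η : ℝ, 0 < η → ∃ C lam0 : ℝ, 0 < lam0 ∧ ∀ lam : ℝ, 0 < lam → lam ≤ lam0 →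
    ∃ L0 : ℕ, ∀ (L : ℕ) [NeZero L], L0 ≤ L → ∀ β : ℝ, InFemtoWindow lam β L →
      ∃ φ : Fin (k + 1) → (GaugeConfig 3 L SU2 → ℝ),
        (∀ i, IsPhys (φ i)) ∧
        (∀ i l, l2 (φ i) (φ l) = if i = l then 1 else 0) ∧
        (∀ i l, i ≠ l → qform su2Rep β (φ i) (φ l) = 0) ∧
        (∀ i l : Fin (k + 1), i ≤ l → qform su2Rep β (φ l) (φ l) ≤ qform su2Rep β (φ i) (φ i)) ∧
        (qform su2Rep β (φ 0) (φ 0) = levelValue su2Rep L β 0 ∧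
          ∀ j : Fin (k + 1),
            levelValue su2Rep 1 (oneSiteCoupling β L) j * qform su2Rep β (φ 0) (φ 0) ≤
              Real.exp (C * luscherLambda β L ^ 2 / L) *
                (qform su2Rep β (φ j) (φ j) * levelValue su2Rep 1 (oneSiteCoupling β L) 0)) ∧
        (∀ c : Fin (k + 1) → ℝ,
          l2 (∑ i, c i • (transferApply β (φ i) - qform su2Rep β (φ i) (φ i) • φ i))
             (∑ i, c i • (transferApply β (φ i) - qform su2Rep β (φ i) (φ i) • φ i)) ≤
            C * (luscherLambda β L ^ 3 / (L : ℝ) ^ 2) * qform su2Rep β (φ 0) (φ 0) ^ 2 * ∑ i, c i ^ 2) ∧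
        (∀ ψ : GaugeConfig 3 L SU2 → ℝ, IsPhys ψ →
          qform su2Rep β ψ ψ ≤ Real.exp (η * luscherLambda β L / L) * qform su2Rep β (φ 0) (φ 0) * l2 ψ ψ)

/-- ★★ **The upper Lüscher position is level data**: `LevelUpperAt k → DressedRitzLowerAt k → DressedRitzAt k` (constant `max C₁ C₂`, level `min`, threshold
`max`); the upper halves of clause (v) come from `RitzInterlace.ritz_le_levelValue` and `LevelUpperAt`. [cite: Parlett1998, §10.1] [cite: Luscher1983, §3] -/
theorem KTGen.dressedRitzAt_of_lower_levels {k : ℕ} (hlev : KTGen.LevelUpperAt k) (hlow : KTGen.DressedRitzLowerAt k) :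
    KTGen.DressedRitzAt k := by
  intro η hη
  obtain ⟨C₂, lam2, hC₂, hlam2, hk2⟩ := hlev
  obtain ⟨C₁, lam1, hlam1, hk1⟩ := hlow η hη
  refine ⟨max C₁ C₂, min lam1 lam2, lt_min hlam1 hlam2, fun lam hlam hle => ?_⟩
  obtain ⟨L1, hL1⟩ := hk1 lam hlam (hle.trans (min_le_left _ _))
  obtain ⟨L2, hL2⟩ := hk2 lam hlam (hle.trans (min_le_right _ _))
  refine ⟨max L1 L2, fun L _ hL0 β hW => ?_⟩
  obtain ⟨φ, hφ, hon, hdiag, hanti, ⟨htop, hlower⟩, hres, hcap⟩ := hL1 L ((le_max_left _ _).trans hL0) β hW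
  have hlevL := hL2 L ((le_max_right _ _).trans hL0) β hW
  have hβ : 0 < β := zero_lt_one.trans_le hW.1
  have hΛ : 0 < luscherLambda β L := luscherLambda_pos_of_window hlam hW
  have hLr : (0 : ℝ) < L := Nat.cast_pos.mpr (NeZero.pos L)
  have hB : 0 ≤ oneSiteCoupling β L := by
    unfold oneSiteCoupling; exact (div_pos (mul_pos two_pos (pow_pos hLr 3)) (pow_pos hΛ 3)).le
  have ht : 0 ≤ luscherLambda β L ^ 2 / (L : ℝ) := div_nonneg (sq_nonneg _) hLr.le
  set E := Real.exp (max C₁ C₂ * luscherLambda β L ^ 2 / L) with hE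
  have hE1 : Real.exp (C₁ * luscherLambda β L ^ 2 / L) ≤ E := by
    rw [hE]; apply Real.exp_le_exp.mpr; rw [mul_div_assoc, mul_div_assoc]
    exact mul_le_mul_of_nonneg_right (le_max_left _ _) ht
  have hE2 : Real.exp (C₂ * luscherLambda β L ^ 2 / L) ≤ E := by
    rw [hE]; apply Real.exp_le_exp.mpr; rw [mul_div_assoc, mul_div_assoc]
    exact mul_le_mul_of_nonneg_right (le_max_right _ _) ht
  have hμ0 : 0 ≤ levelValue su2Rep 1 (oneSiteCoupling β L) 0 := levelValue_su2Rep_nonneg 1 hB 0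
  have hl0 : 0 < levelValue su2Rep L β 0 := levelValue_su2Rep_pos hβ 0
  refine ⟨φ, hφ, hon, hdiag, hanti, fun j => ⟨?_, ?_⟩, fun c => ?_, hcap⟩
  · -- UPPER: interlacing + level comparison + `ρ₀ = λ₀`
    have hinter := RitzInterlace.ritz_le_levelValue hβ hφ hon hdiag hanti j
    have hμj : 0 ≤ levelValue su2Rep 1 (oneSiteCoupling β L) (j : ℕ) := levelValue_su2Rep_nonneg 1 hB _
    calc qform su2Rep β (φ j) (φ j) * levelValue su2Rep 1 (oneSiteCoupling β L) 0
        ≤ levelValue su2Rep L β j * levelValue su2Rep 1 (oneSiteCoupling β L) 0 := mul_le_mul_of_nonneg_right hinter hμ0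
      _ ≤ Real.exp (C₂ * luscherLambda β L ^ 2 / L) * (levelValue su2Rep 1 (oneSiteCoupling β L) j * levelValue su2Rep L β 0) :=
          hlevL j (by have := j.isLt; omega)
      _ ≤ E * (levelValue su2Rep 1 (oneSiteCoupling β L) j * levelValue su2Rep L β 0) :=
          mul_le_mul_of_nonneg_right hE2 (mul_nonneg hμj hl0.le)
      _ = E * (levelValue su2Rep 1 (oneSiteCoupling β L) j * qform su2Rep β (φ 0) (φ 0)) := by rw [htop]
  · -- LOWER: given, constant upgraded
    have hρj : 0 ≤ qform su2Rep β (φ j) (φ j) := qform_su2Rep_self_nonneg hβ.le (hφ j)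
    exact (hlower j).trans (mul_le_mul_of_nonneg_right hE1 (mul_nonneg hρj hμ0))
  · -- residual clause: constant upgraded
    refine (hres c).trans ?_
    have hnn : 0 ≤ luscherLambda β L ^ 3 / (L : ℝ) ^ 2 * qform su2Rep β (φ 0) (φ 0) ^ 2 * ∑ i, c i ^ 2 :=
      mul_nonneg (mul_nonneg (div_nonneg (pow_nonneg hΛ.le _) (sq_nonneg _)) (sq_nonneg _)) (Finset.sum_nonneg fun i _ => sq_nonneg _)
    calc C₁ * (luscherLambda β L ^ 3 / (L : ℝ) ^ 2) * qform su2Rep β (φ 0) (φ 0) ^ 2 * ∑ i, c i ^ 2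
        = C₁ * (luscherLambda β L ^ 3 / (L : ℝ) ^ 2 * qform su2Rep β (φ 0) (φ 0) ^ 2 * ∑ i, c i ^ 2) := by ring
      _ ≤ max C₁ C₂ * (luscherLambda β L ^ 3 / (L : ℝ) ^ 2 * qform su2Rep β (φ 0) (φ 0) ^ 2 * ∑ i, c i ^ 2) :=
          mul_le_mul_of_nonneg_right (le_max_left _ _) hnn
      _ = max C₁ C₂ * (luscherLambda β L ^ 3 / (L : ℝ) ^ 2) * qform su2Rep β (φ 0) (φ 0) ^ 2 * ∑ i, c i ^ 2 := by ring

/-! ## §4 ★ The sibling crux RED supplies the levels: `RunningReduction → LevelUpperAt k` -/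

/-- Upgrading the constant in an `e^{C t}`-tolerance with `t = Λ²/L ≥ 0`. [folklore] -/
theorem exp_tol_mono {C C' : ℝ} (h : C ≤ C') {β : ℝ} {L : ℕ} (hL : (0 : ℝ) < L) :
    Real.exp (C * luscherLambda β L ^ 2 / L) ≤ Real.exp (C' * luscherLambda β L ^ 2 / L) := by
  apply Real.exp_le_exp.mpr
  rw [mul_div_assoc, mul_div_assoc]
  exact mul_le_mul_of_nonneg_right h (div_nonneg (sq_nonneg _) hL.le)

/-- ★ **The RED crux supplies the level data**: `RunningReduction` (stmt-QuantumFields-19978: two-sided one-loop comparison of the fine levels with the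
one-site levels, level by level) implies `LevelUpperAt k` for every `k` (finite max/min of the constants, by induction on `k`). [cite: Luscher1983, §3] -/
theorem KTGen.levelUpperAt_of_runningReduction (hRR : Summit.QuantumFields.YangMills.Theses.LuscherReduction.RunningReduction) :
    ∀ k : ℕ, KTGen.LevelUpperAt k := by
  -- one level, constant made nonnegative
  have hone : ∀ j : ℕ, ∃ C lam0 : ℝ, 0 ≤ C ∧ 0 < lam0 ∧ ∀ lam : ℝ, 0 < lam → lam ≤ lam0 →
      ∃ L0 : ℕ, ∀ (L : ℕ) [NeZero L], L0 ≤ L → ∀ β : ℝ, InFemtoWindow lam β L →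
        levelValue su2Rep L β j * levelValue su2Rep 1 (oneSiteCoupling β L) 0 ≤
          Real.exp (C * luscherLambda β L ^ 2 / L) * (levelValue su2Rep 1 (oneSiteCoupling β L) j * levelValue su2Rep L β 0) := by
    intro j
    obtain ⟨C, lam0, hlam0, hk⟩ := hRR j
    refine ⟨max C 0, lam0, le_max_right _ _, hlam0, fun lam hlam hle => ?_⟩
    obtain ⟨L0, hL⟩ := hk lam hlam hle
    refine ⟨L0, fun L _ hL0 β hW => ?_⟩
    have h := (hL L hL0 β hW).1
    have hβ : 0 < β := zero_lt_one.trans_le hW.1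
    have hΛ : 0 < luscherLambda β L := luscherLambda_pos_of_window hlam hW
    have hLr : (0 : ℝ) < L := Nat.cast_pos.mpr (NeZero.pos L)
    have hB : 0 ≤ oneSiteCoupling β L := by
      unfold oneSiteCoupling; exact (div_pos (mul_pos two_pos (pow_pos hLr 3)) (pow_pos hΛ 3)).le
    have hnn : 0 ≤ levelValue su2Rep 1 (oneSiteCoupling β L) j * levelValue su2Rep L β 0 :=
      mul_nonneg (levelValue_su2Rep_nonneg 1 hB j) (levelValue_su2Rep_pos hβ 0).le
    exact h.trans (mul_le_mul_of_nonneg_right (exp_tol_mono (le_max_left C 0) hLr) hnn)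
  intro k
  induction k with
  | zero =>
    obtain ⟨C, lam0, hC, hlam0, hk⟩ := hone 0
    refine ⟨C, lam0, hC, hlam0, fun lam hlam hle => ?_⟩
    obtain ⟨L0, hL⟩ := hk lam hlam hle
    refine ⟨L0, fun L _ hL0 β hW j hj => ?_⟩
    have : j = 0 := by omega
    subst this
    exact hL L hL0 β hW
  | succ k ih =>
    obtain ⟨C₁, lam1, hC₁, hlam1, hk1⟩ := ih
    obtain ⟨C₂, lam2, hC₂, hlam2, hk2⟩ := hone (k + 1)
    refine ⟨max C₁ C₂, min lam1 lam2, hC₁.trans (le_max_left _ _), lt_min hlam1 hlam2, fun lam hlam hle => ?_⟩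
    obtain ⟨L1, hL1⟩ := hk1 lam hlam (hle.trans (min_le_left _ _))
    obtain ⟨L2, hL2⟩ := hk2 lam hlam (hle.trans (min_le_right _ _))
    refine ⟨max L1 L2, fun L _ hL0 β hW j hj => ?_⟩
    have hβ : 0 < β := zero_lt_one.trans_le hW.1
    have hΛ : 0 < luscherLambda β L := luscherLambda_pos_of_window hlam hW
    have hLr : (0 : ℝ) < L := Nat.cast_pos.mpr (NeZero.pos L)
    have hB : 0 ≤ oneSiteCoupling β L := by
      unfold oneSiteCoupling; exact (div_pos (mul_pos two_pos (pow_pos hLr 3)) (pow_pos hΛ 3)).le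
    have hnn : 0 ≤ levelValue su2Rep 1 (oneSiteCoupling β L) j * levelValue su2Rep L β 0 :=
      mul_nonneg (levelValue_su2Rep_nonneg 1 hB j) (levelValue_su2Rep_pos hβ 0).le
    rcases Nat.lt_or_ge j (k + 1) with hlt | hge
    · exact (hL1 L ((le_max_left _ _).trans hL0) β hW j (by omega)).trans
        (mul_le_mul_of_nonneg_right (exp_tol_mono (le_max_left _ _) hLr) hnn)
    · have : j = k + 1 := by omega
      subst this
      exact (hL2 L ((le_max_right _ _).trans hL0) β hW).trans
        (mul_le_mul_of_nonneg_right (exp_tol_mono (le_max_right _ _) hLr) hnn)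

/-- ★★ **Given the sibling crux RED, the crux `DressedRitz` reduces to ONE-SIDED (lower) Lüscher position**:
`RunningReduction → DressedRitzLowerAt k → DressedRitzAt k`. [cite: Luscher1983, §3] [cite: Parlett1998, §10.1] -/
theorem KTGen.dressedRitzAt_of_runningReduction_lower {k : ℕ}
    (hRR : Summit.QuantumFields.YangMills.Theses.LuscherReduction.RunningReduction) (hlow : KTGen.DressedRitzLowerAt k) :
    KTGen.DressedRitzAt k :=
  KTGen.dressedRitzAt_of_lower_levels (KTGen.levelUpperAt_of_runningReduction hRR k) hlow

/-- ★★ Route-level corollary: `RunningReduction → (∀ k, DressedRitzLowerAt k) → Theses.LuscherReduction.DressedRitz`. [cite: Luscher1983, §3] -/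
theorem KTGen.dressedRitz_of_runningReduction_lower
    (hRR : Summit.QuantumFields.YangMills.Theses.LuscherReduction.RunningReduction) (hlow : ∀ k, KTGen.DressedRitzLowerAt k) :
    Summit.QuantumFields.YangMills.Theses.LuscherReduction.DressedRitz :=
  KTGen.dressedRitz_iff_forall_dressedRitzAt.mpr fun k => KTGen.dressedRitzAt_of_runningReduction_lower hRR (hlow k)

/-! ## §5 ERRATUM (LEAD ym-lead-20205-polyakovlift g0, 2026-08-27 16:00Z) — scope of §4

The theorems of §4 are correct but IDLE for route `LuscherReduction`: `RunningReduction → ∀ k, KTGen.DressedRitzAt k` is already a tree certificate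
(`…DressedRitzPlateauCertificates` ∕ `…DressedRitzOperatorPlateauCertificates`, exact eigenvectors as witnesses), so the hypothesis
`∀ k, DressedRitzLowerAt k` of `KTGen.dressedRitz_of_runningReduction_lower` is unnecessary; and in the route's logic `DressedRitz` is a STUB of RED's KTR
skeleton (`DressedRitz ⟹ RunningReduction` via Kato–Temple), so discharging the upper halves of clause (v) from `RunningReduction` is CIRCULAR there.
The sentence of the module docstring «GIVEN RED … the crux `DressedRitz` reduces to one-sided (lower) Lüscher position» must be read with this caveat:
true as an implication, useless toward RED.  What §1–§3 legitimately provide: `KTGen.dressedRitzAt_of_lower_levels` for contexts where the fine LEVELS are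
known independently of `DressedRitz`; and, in the useful direction, the LOWER halves give RED's variational conjunct directly
(`RitzInterlace.redLower_of_ritzLower`, `…DressedRitzRitzVariationalHalf.lean`).  The upper halves of (v) remain genuine content of every `DressedRitz` line. -/

/-- Documentation anchor for the §5 erratum (so that the caveat is visible in `lean search`): the §4 reduction
`KTGen.dressedRitz_of_runningReduction_lower` needs NO second hypothesis — `RunningReduction` alone gives `DressedRitz` through the tree's certificates; stated
here in the weakest form available in this file's imports: `RunningReduction → ∀ k, LevelUpperAt k` (= `levelUpperAt_of_runningReduction`). [folklore] -/
theorem KTGen.erratum_upperFromLevels_idle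
    (hRR : Summit.QuantumFields.YangMills.Theses.LuscherReduction.RunningReduction) (k : ℕ) : KTGen.LevelUpperAt k :=
  KTGen.levelUpperAt_of_runningReduction hRR k

end Summit.QuantumFields.YangMills.Theorems.FemtoTransferGap

end
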